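import Literature.AnabelianGeometry.SemiGraphs.ProSigmaCompletionQuotients
import Literature.AnabelianGeometry.SemiGraphs.ProSigmaCompletionInjective
import Literature.GroupTheory.CombinatorialGroupTheory.PuncturedSurfaceGroupFreeCuspActions
import Mathlib.GroupTheory.SpecificGroups.Cyclic

/-!
# Open subgroups of index `ℓ²` of a pro-`Σ` surface group on whose cosets every cusp acts freely
([SemiAnbd] Ex. 2.10 (3))

Mochizuki, *Semi-graphs of anabelioids*, Publ. RIMS **42** (2006), Example 2.10 p. 31: the
semi-graph of anabelioids of a pointed stable curve is "… totally universally sub-coverticial …".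
A closed edge `e` of a semi-graph of anabelioids `𝒢` of surface type is made sub-coverticial
([SemiAnbd] Def. 2.4 (iii)) by the finite étale covering `𝒢_A → 𝒢` attached to an object
`A = {S_v, T_e, ψ_b}` of `B(𝒢)` ([SemiAnbd] Def. 2.2 (i); the tree's `BObj.coveringGraph`) in which
`S_v`, `S_w` are CONNECTED at the end-points of `e` and the branch groups of `e` act on their fibres
with `≥ 2` orbits, all cusps acting with one and the same cycle type so that the two restrictions
to every edge group are isomorphic.  This proof-only file (cell abc-iut, layer L3, row G31 (3), seat
abc-iut-L3-t4) supplies the vertex-level input over abc-iut-L3-t1's interface `IsOfSurfaceType` /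
`IsProSigmaCompletion` (`Coverticial.lean`): (1) finite quotients of the abstract surface group with
`Σ`-integer index extend along the pro-`Σ` completion `ι : Γ → Π_v` to homomorphisms of `Π_v` with
open kernel and the same image (`IsProSigmaCompletion.exists_hom_extension`); (2) for a prime
`ℓ ∈ Σ`, an open subgroup `H̃ ⊆ Π_v` of index `ℓ²` such that for every branch `b` at `v` and every
`γ ∈ Π_v`, `[Π_b : Π_b ∩ γ H̃ γ⁻¹] = ℓ` — every `Π_b`-orbit on `Π_v/H̃` has exactly `ℓ` elements
(`IsOfSurfaceType.exists_open_subgroup_cusps_free`), from the discrete statement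
`PuncturedSurfaceGroup.exists_hom_transitive_cusps_free`.  Plain profinite group theory; no
statement here takes a side on any disputed claim.
-/

namespace Literature.AnabelianGeometry.SemiGraphs.SemiGraphOfAnabelioids.IsProSigmaCompletion

open Literature.AnabelianGeometry.Anabelioids Topology Pointwise
open Literature.GroupTheory.CombinatorialGroupTheory
open Literature.GroupTheory.CombinatorialGroupTheory.PuncturedSurfaceGroup

variable {Sigma : Set ℕ} {P : Type*} [Group P] [TopologicalSpace P] [IsTopologicalGroup P]

/-! ### Extending finite quotients of `Γ` along the completion -/

/-- **Universal property, homomorphism form.** For a pro-`Σ` completion `ι : Γ → P` and a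
homomorphism `f : Γ → G` whose kernel has `Σ`-integer index, there is a homomorphism `Λ : P → G`
with OPEN kernel, `Λ ∘ ι = f` and `Λ(P) = f(Γ)`. [cite: MochizukiSemiAnbd2006, Ex. 2.10 p.31] -/
theorem exists_hom_extension {Γ : Type*} [Group Γ] {ι : Γ →* P} (hι : IsProSigmaCompletion Sigma ι)
    {G : Type*} [Group G] (f : Γ →* G) (hf : IsSigmaInteger Sigma f.ker.index) :
    ∃ Λ : P →* G, IsOpen (Λ.ker : Set P) ∧ (∀ γ, Λ (ι γ) = f γ) ∧ Λ.range = f.range := by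
  obtain ⟨W, hWo, hWK⟩ := hι.comap_surj f.ker inferInstance hf
  have hWn : W.Normal := normal_of_comap_normal hι W hWo (by rw [hWK]; infer_instance)
  haveI := hWn
  let π : P →* P ⧸ W := QuotientGroup.mk' W
  let E₁ : Γ ⧸ W.comap ι ≃* P ⧸ W :=
    MulEquiv.ofBijective (QuotientGroup.map (W.comap ι) W ι le_rfl) (bijective_quotientMap hι W hWo)
  let e₂ : Γ ⧸ W.comap ι →* G := QuotientGroup.lift (W.comap ι) f hWK.le
  let Λ' : P ⧸ W →* G := e₂.comp E₁.symm.toMonoidHom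
  have hE₁ : ∀ γ, π (ι γ) = E₁ (QuotientGroup.mk γ) := fun γ => rfl
  have hΛ' : ∀ γ, Λ' (π (ι γ)) = f γ := by
    intro γ
    change e₂ (E₁.symm (π (ι γ))) = f γ
    rw [hE₁, MulEquiv.symm_apply_apply]
    rfl
  have hΛ'inj : Function.Injective Λ' := by
    refine (injective_iff_map_eq_one _).2 fun x hx => ?_
    obtain ⟨y, rfl⟩ := E₁.surjective x
    obtain ⟨γ, rfl⟩ := QuotientGroup.mk_surjective y
    change e₂ (E₁.symm (E₁ _)) = 1 at hx
    rw [MulEquiv.symm_apply_apply] at hx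
    change f γ = 1 at hx
    have h1 : (QuotientGroup.mk γ : Γ ⧸ W.comap ι) = 1 := by
      rw [QuotientGroup.eq_one_iff, hWK]; exact hx
    rw [h1, map_one]
  refine ⟨Λ'.comp π, ?_, fun γ => hΛ' γ, ?_⟩
  · have hker : ((Λ'.comp π).ker : Set P) = W := by
      ext x
      rw [SetLike.mem_coe, MonoidHom.mem_ker, MonoidHom.comp_apply, ← map_one Λ',
        hΛ'inj.eq_iff, SetLike.mem_coe]
      exact QuotientGroup.eq_one_iff x
    rw [hker]; exact hWo
  · apply le_antisymm
    · rintro _ ⟨x, rfl⟩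
      obtain ⟨y, hy⟩ := E₁.surjective (π x)
      obtain ⟨γ, rfl⟩ := QuotientGroup.mk_surjective y
      refine ⟨γ, ?_⟩
      show f γ = Λ' (π x)
      rw [← hΛ', hE₁, hy]
    · rintro _ ⟨γ, rfl⟩
      exact ⟨ι γ, hΛ' γ⟩

/-! ### Open subgroups on whose cosets all cusps act freely with `ℓ`-cycles -/

variable {g r : ℕ} {ι : PuncturedSurfaceGroup g r →* P}

omit [TopologicalSpace P] [IsTopologicalGroup P] in
/-- Pulling back a conjugate is conjugating the pull-back (by any lift). [folklore] -/
private theorem comap_conj_eq {G : Type*} [Group G] (Λ : P →* G) (H : Subgroup G) (γ : P) :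
    ConjAct.toConjAct γ • H.comap Λ = (ConjAct.toConjAct (Λ γ) • H).comap Λ := by
  ext x
  rw [Subgroup.mem_pointwise_smul_iff_inv_smul_mem, Subgroup.mem_comap, Subgroup.mem_comap,
    Subgroup.mem_pointwise_smul_iff_inv_smul_mem, ← ConjAct.toConjAct_inv, ← ConjAct.toConjAct_inv,
    ConjAct.toConjAct_smul, ConjAct.toConjAct_smul, map_mul, map_mul, map_inv, inv_inv, inv_inv]

/-- **Free cusp actions on a finite quotient.** Let `ι : Γ_{g,r} → P` be a pro-`Σ` completion of a
hyperbolic punctured surface group and `ℓ ∈ Σ` a prime.  There is an open subgroup `H̃ ⊆ P` of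
index `ℓ ^ 2` such that for every cusp `j`, every closed subgroup `B = (ι⟨c_j⟩)⁻` and every
`γ ∈ P`: `[B : B ∩ γ H̃ γ⁻¹] = ℓ` — i.e. every `B`-orbit on `P/H̃` has exactly `ℓ` elements (so
`≥ 2` orbits, all of the same size, for every cusp). [cite: MochizukiSemiAnbd2006, Ex. 2.10 p.31] -/
theorem exists_open_subgroup_cusps_free (hι : IsProSigmaCompletion Sigma ι) (h : IsHyperbolicType g r)
    {ℓ : ℕ} (hℓ : ℓ.Prime) (hℓS : ℓ ∈ Sigma) :
    ∃ Ht : Subgroup P, IsOpen (Ht : Set P) ∧ Ht.index = ℓ ^ 2 ∧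
      ∀ (j : Fin r) (B : Subgroup P),
        (B : Set P) = closure (ι '' ((cuspInertia (g := g) j : Subgroup (PuncturedSurfaceGroup g r)) :
          Set (PuncturedSurfaceGroup g r))) →
        ∀ γ : P, ((ConjAct.toConjAct γ • Ht).subgroupOf B).index = ℓ := by
  haveI : Fact ℓ.Prime := ⟨hℓ⟩
  obtain ⟨G, _, _, f, H, hG, hfs, hHidx, hcusp⟩ := exists_hom_transitive_cusps_free (g := g) h hℓ
  -- `ker f` has index `|G| ∣ ℓ³`: extend `f` to `Λ : P ↠ G` with open kernel
  have hKS : IsSigmaInteger Sigma f.ker.index := by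
    refine (isSigmaInteger_prime_pow hℓ hℓS 3).of_dvd ?_
    rw [Subgroup.index_ker, MonoidHom.range_eq_top.2 hfs, Subgroup.card_top]
    exact hG
  obtain ⟨Λ, hΛo, hΛι, hΛr⟩ := hι.exists_hom_extension f hKS
  have hΛs : Function.Surjective Λ := by
    rw [← MonoidHom.range_eq_top, hΛr, MonoidHom.range_eq_top]; exact hfs
  refine ⟨H.comap Λ, ?_, ?_, fun j B hB γ => ?_⟩
  · exact Subgroup.isOpen_mono (fun x hx => by
      rw [Subgroup.mem_comap, (MonoidHom.mem_ker).1 hx]; exact H.one_mem) hΛo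
  · rw [Subgroup.index_comap_of_surjective _ hΛs, hHidx]
  · -- the image of `B = (ι⟨c_j⟩)⁻` under `Λ` is `⟨f(c_j)⟩`, of prime order `ℓ`
    obtain ⟨hpow, hfree⟩ := hcusp j
    have hne : f (c j) ≠ 1 := fun h1 => hfree 1 (by rw [h1, mul_one, one_mul, inv_one]; exact H.one_mem)
    have hord : orderOf (f (c j)) = ℓ := orderOf_eq_prime hpow hne
    let C : Subgroup G := Subgroup.zpowers (f (c j))
    have hcardC : Nat.card C = ℓ := by rw [Nat.card_zpowers, hord]
    haveI : Fact (Nat.card C).Prime := ⟨hcardC ▸ hℓ⟩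
    have hBC : B.map Λ = C := by
      apply le_antisymm
      · -- `Λ⁻¹(C)` is an open, hence closed, subgroup containing `ι⟨c_j⟩`
        have hcl : IsClosed ((C.comap Λ : Subgroup P) : Set P) := by
          refine Subgroup.isClosed_of_isOpen _ (Subgroup.isOpen_mono (fun x hx => ?_) hΛo)
          rw [Subgroup.mem_comap, (MonoidHom.mem_ker).1 hx]; exact C.one_mem
        have hsub : ι '' ((cuspInertia (g := g) j : Subgroup (PuncturedSurfaceGroup g r)) :
            Set (PuncturedSurfaceGroup g r)) ⊆ ((C.comap Λ : Subgroup P) : Set P) := by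
          rintro _ ⟨δ, hδ, rfl⟩
          rw [SetLike.mem_coe, PuncturedSurfaceGroup.cuspInertia, Subgroup.mem_zpowers_iff] at hδ
          obtain ⟨m, rfl⟩ := hδ
          rw [SetLike.mem_coe, Subgroup.mem_comap, hΛι, map_zpow]
          exact ⟨m, rfl⟩
        have hle : (B : Set P) ⊆ ((C.comap Λ : Subgroup P) : Set P) := by
          rw [hB]; exact hcl.closure_subset_iff.2 hsub
        exact Subgroup.map_le_iff_le_comap.2 hle
      · rw [Subgroup.zpowers_le, ← hΛι]
        refine ⟨ι (c j), ?_, rfl⟩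
        rw [hB]
        exact subset_closure ⟨c j, Subgroup.mem_zpowers _, rfl⟩
    -- `B ∩ γ H̃ γ⁻¹ = B ∩ Λ⁻¹(q H q⁻¹)`, `q = Λ γ`; its index in `B` is that of `C ∩ qHq⁻¹` in `C`
    rw [comap_conj_eq]
    set Hq : Subgroup G := ConjAct.toConjAct (Λ γ) • H with hHq
    have hrange : (Λ.comp B.subtype).range = C := by
      rw [MonoidHom.range_comp, Subgroup.range_subtype, hBC]
    have hidx : ((Hq.comap Λ).subgroupOf B).index = (Hq.subgroupOf C).index := by
      rw [Subgroup.subgroupOf, Subgroup.comap_comap, Subgroup.index_comap, hrange]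
      rfl
    rw [hidx]
    -- `C` has prime order and `f(c_j) ∈ C ∖ qHq⁻¹`
    rcases (Hq.subgroupOf C).eq_bot_or_eq_top_of_prime_card with hbot | htop
    · rw [hbot, Subgroup.index_bot, hcardC]
    · exfalso
      have hmem : f (c j) ∈ Hq := by
        have : (⟨f (c j), Subgroup.mem_zpowers _⟩ : C) ∈ Hq.subgroupOf C := by rw [htop]; trivial
        exact this
      rw [hHq, Subgroup.mem_pointwise_smul_iff_inv_smul_mem, ← ConjAct.toConjAct_inv,
        ConjAct.toConjAct_smul, inv_inv] at hmem
      exact hfree (Λ γ)⁻¹ (by rwa [inv_inv])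

end Literature.AnabelianGeometry.SemiGraphs.SemiGraphOfAnabelioids.IsProSigmaCompletion

/-! ### At a vertex of surface type -/

namespace Literature.AnabelianGeometry.SemiGraphs.SemiGraphOfAnabelioids

open CategoryTheory CategoryTheory.PreGaloisCategory Topology Pointwise
open Literature.AnabelianGeometry.Anabelioids
open Literature.GroupTheory.CombinatorialGroupTheory

universe v₁ u₁ u

/-- **Free branch actions at a surface-type vertex.** For `𝒢` of surface type, a vertex `v` with
basepoint `F` and a prime `ℓ ∈ Σ`: an open subgroup `H̃ ⊆ Π_v = Aut F` of index `ℓ ^ 2` such that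
for every branch `b` at `v` and every basepoint of `𝒢_e`, the representative `Π_b` supplied by the
surface structure satisfies `[Π_b : Π_b ∩ γ H̃ γ⁻¹] = ℓ` for all `γ ∈ Π_v` — the finite `Π_v`-set
`Π_v/H̃` is transitive and every `Π_b` acts on it with all orbits of size `ℓ` (the local datum of a
covering splitting every edge at `v` into `ℓ ≥ 2` coverticial edges, [SemiAnbd] Def. 2.4 (iii)).
[cite: MochizukiSemiAnbd2006, Ex. 2.10 p.31] -/
theorem IsOfSurfaceType.exists_open_subgroup_cusps_free {𝒢 : SemiGraphOfAnabelioids.{v₁, u₁, u}}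
    {Sigma : Set ℕ} (hS : 𝒢.IsOfSurfaceType Sigma) (v : 𝒢.graph.Vertex)
    (F : 𝒢.V v ⥤ FintypeCat.{v₁}) [FiberFunctor F] {ℓ : ℕ} (hℓ : ℓ.Prime) (hℓS : ℓ ∈ Sigma) :
    ∃ Ht : Subgroup (Aut F), IsOpen (Ht : Set (Aut F)) ∧ Ht.index = ℓ ^ 2 ∧
      ∀ (b : {b : 𝒢.graph.Branch // 𝒢.graph.abuts b = some v})
        (Fe : 𝒢.E (𝒢.graph.edgeOf b.1) ⥤ FintypeCat.{v₁}) [FiberFunctor Fe],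
        ∃ α : (𝒢.pull b.1 v b.2).pullback ⋙ Fe ≅ F, ∀ γ : Aut F,
          ((ConjAct.toConjAct γ • Ht).subgroupOf (𝒢.branchSubgroup F b.1 b.2 Fe α)).index = ℓ := by
  obtain ⟨g, r, ι, hh, hι, js, -, hbr⟩ := hS.vertex v F
  obtain ⟨Ht, hHo, hHidx, hH⟩ := hι.exists_open_subgroup_cusps_free hh hℓ hℓS
  refine ⟨Ht, hHo, hHidx, fun b Fe _ => ?_⟩
  obtain ⟨α, hα⟩ := hbr b Fe
  exact ⟨α, hH (js b) _ hα⟩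

end Literature.AnabelianGeometry.SemiGraphs.SemiGraphOfAnabelioids
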